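import Summits.BirchSwinnertonDyer.Rank1Residual.F1Sign2.TamagawaExponentAtTwo
import Summits.BirchSwinnertonDyer.Rank1Residual.F1Sign2.RealComponentAtTwo
import Mathlib.NumberTheory.Padics.PadicNumbers
import Literature.NumberTheory.EllipticCurves.MordellWeil
import HarnessLib.Audit.Tags
import HarnessLib

/-!
# Cell `bsd-f1-sign2` — Euler-system lens (planner `-es` g28; MEMO-es §37, CensusES37.md): ES-37 — THE GOOD ORDINARY PRIME 2 IS A PLACE OF THE
# 2-ADIC FLOOR OF THE MODULAR DEGREE, KEYED BY THE GAUSSIAN NORM CLASS `(Δ_E, −1)₂`; ITS ABSORBING FUNCTIONAL IS THE RAMIFICATION OF THE LOCAL KUMMER CLASS.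

STATEMENTS ONLY (crux workfile of `stmt-BirchSwinnertonDyer-23715`, `RankOneAtTwoBigImageOddLocal`; nothing below is a theorem beyond print; BSD is not proved).
Self-contained successor of `RelaxedSelmerFloorES36.lean` (v8, g27): the LAW-H / LAW-P vocabulary is repeated verbatim in this namespace (the ES36 module is a
workfile, not a library target), then three new laws are typed.  Population of every census: Cremona, optimal curve of each isogeny class, `N < 5·10⁵`
squarefree, `E(ℚ)[2] = 0`, `Δ_min ∉ ℚ^{×2}` (431 171 curves, ranks 0–4; ENGINE 37z rows, four parts).  `v := v₂(m_E) − (ω(N) − 1)`.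

WHAT IS NEW (ENGINES 37z / 37y / 37w / 37v / 37d, analyzers 37A–37G, 2026-08-30):
* ES-37A `GeometricLengthPairingDivisibilityAtTwo` — LAW GP: LAW P (ES-36L) with the Tamagawa 2-length `Σ ord₂ c_q` replaced by the GEOMETRIC 2-length
  `Σ_{q ∈ β∪γ} ord₂ v_q(Δ)` (`#Φ_q(𝔽̄_q) = v_q(Δ)`; Ribet–Takahashi / Takahashi degree of the Tate parametrisation; REF1 §PG): **0 / 431 171, 179 688 tight
  (LAW P 156 268), 1 525 / 1 525 cells `(r, signΔ, place signature with ord₂ v_q(Δ), a_N, a_K)` (n ≥ 20) attained**; strictly above LAW H on 53 085 curves.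
* THE GOOD PRIME 2 (odd `N`).  Sort odd-`N` curves by `ρ̄_{E,2}|G_{ℚ₂}`: A supersingular; B ordinary with `Δ ≡ 3 (mod 4)` (`ρ̄` ramified at 2, `(Δ,−1)₂ = −1`);
  C ordinary, `Δ ≡ 5 (mod 8)` (`ρ̄` unramified, `Frob₂` a transposition); D ordinary, `Δ ≡ 1 (mod 8)` (`ρ̄(Frob₂) = 1`).  Rank-0 LAW-GP tightness: A 44.3 % (26 385),
  B 17.3 % (9 943), C 4.0 % (4 834), D 3.0 % (3 132) — a graded deficit that follows Kramer's local norm index `i₂(χ₋₄) ∈ {0, 1, 2}` of `E` over `ℚ(√−1)`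
  [cite: Kramer1981, Prop. 3–6], NOT `dim E(ℚ₂)[2]` (pre-registered prediction P37.11 «C ≈ B» refuted: C ≈ D).  Two typed readings repair it:
  - ES-37B `GaussianNormDivisibilityAtTwo` (LAW K; classes C ∪ D = ordinary with `(Δ,−1)₂ = +1`): the prime 2 is a K-type place of WEIGHT 1 whose absorbing functional is
    `λ₂(P) = [the Kummer class of P in H¹(ℚ₂, E[2]) is RAMIFIED]` = `[ℚ₂(½P)/ℚ₂ ramified]` (D: `(−1, x(P) − x(T₁))₂ = −1` for an integral 2-torsion abscissa; C: over
    `F = ℚ₂(x(T₁)) = ℚ₂(√5)`, `(ε, x(P) − x(T₁))_F = −1` with `N_{F/ℚ₂} ε = −1`; basis-free: `Tr(α³) − N(α³) ≡ 5 (mod 8)` for the unit-normalised `α = x(P) − x(T₁)`,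
    ENGINE 37v = 37w on 15 355 / 15 355 generator values): **0 / 26 201 curves (C 16 457, D 9 744); tight 6 193 + 3 294 (GP: 2 413 + 1 476); fine cells C 78/78 (r ≥ 1) + 30/30 (r = 0),
    D 45/45 + 18/18 attained**; weight 2 (= `i₂`) is refuted by 2 325 rank-0 curves at `v = τ_G + 1`; every `κ_{T₀}`-functional fails at C (≤ 68/72 cells).
  - ES-37C `EtaleParityDivisibilityAtTwo` (LAW Et; all ordinary classes B ∪ C ∪ D): the prime 2 may be ADJOINED as an N-type (parity-counted) place of weight 0 with functional
    `φ₂(P) = [κ_{T₀}(P) ≠ 1] = [P ∉ ψ̂E′(ℚ₂)]` (the étale = unramified coordinate; `κ_{T₀}(P) ∈ {1, 5}·ℚ₂^{×2}` on all 58 041 generator values): **0 / 61 826 (B 35 625,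
    C 16 457, D 9 744); B: 13 706 tight vs GP 11 599**; with the zero functional it fails 7 723 + 1 756 + 1 141 times, on supersingular curves 5 152 times.
  LAW M := GP ∧ K ∧ Et (the floor is the max): **0 / 431 171; 188 758 tight (43.8 %); rank-0 tightness B 30.4 %, C 31.1 %, D 26.3 %; cells 1 525 / 1 525 and, keyed also by the
  class at 2, 2 015 / 2 015; held out by conductor (LAW K2 ⊂ M): `N < 2.5·10⁵` 1 200 / 1 201, `N ≥ 2.5·10⁵` 1 246 / 1 246.**
* UNIFORM DESCRIPTION (the lens's answer to «what is the signed object at 2»).  Every K-type functional of LAW H/P/GP/K is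
  `λ_v(P) = (ε_v, x(P) − x(T₁))_{F_v}`, `F_v = ℚ_v(x(T₁))` the étale algebra of the non-canonical 2-torsion pair, `N_{F_v/ℚ_v} ε_v = −1`:
  `∞` (component), split γ `q ≡ 3 (4)` (`(−1,u_P)_q`), split γ₂ (`χ₋₄(u_P)`), good ordinary 2 with `(Δ,−1)₂ = +1` (above); and the place is ABSENT exactly when no `ε_v` of norm
  `−1` exists or the symbol is trivial: `Δ < 0` at `∞`, `q ≡ 1 (4)`, class B (`−1 ∉ N(ℚ₂(√Δ)^×)`), supersingular 2.  The signed object is the class of `−1` in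
  `ℚ_v^×/N(ℚ_v(E[2])^×)` paired with the `T₁`-Kummer coordinate — the local condition of the GAUSSIAN TWIST `E^{(−1)}` (Kramer / Mazur–Rubin `H¹_F ∩ H¹_{F^χ}`).
* FIRST RUNG IN PRINT: at prime level, rank 0, no even Tamagawa place, LAW M says `2 ∣ m_E` iff `E` is ordinary at 2 or `Δ > 0` — this is Calegari–Emerton's theorem
  [cite: CalegariEmerton2009, Thm. 1 (3b)]; the class-D witnesses 503b1, 2071a1, 2089c1 are Kilford's / Ribet–Stein's non-Gorenstein levels [cite: KilfordWiese2008, Thm. 1.3, §1.1].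
  Beyond it (not in print, searched): additivity with `ω − 1`, the Tamagawa 2-lengths and the real place; the weight/functional at composite level; positive rank; and the
  prediction `4 ∣ m_E` for rank-0 ordinary curves with `Δ > 0`, `Δ ≡ 1 (4)` and no even Tamagawa prime (1 139 / 1 139 in range, 0 at `v = 1`).
* v2 (same day, ENGINES 37s/37t): ES-37P `PrimeLevelReciprocityAtTwo` — at PRIME level LAW M is EXACT on generic generators: `v₂(m_E) = 1` iff the rank is 1 and the generator's
  Kummer class is generic at every floor place (`Δ < 0`, ordinary: 395 / 395, typed as `PrimeLevelKummerReciprocityAtTwo`; `Δ > 0`, `ρ̄` ramified at 2: 436 / 436 with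
  `Ш_an = 1`, the 11 `Ш_an = 4` curves at `v₂ ≥ 3`), and a non-generic generator or even rank costs 2, not 1, in the ramified cells (`4 ∣ m_E` for class B `Δ < 0` even rank,
  425 / 425; `8 ∣ m_E` for class B `Δ < 0` rank 1 special, 139 / 139; supersingular `Δ < 0` even rank never `2 ∥ m_E`, 879 / 879).  `λ₂(T₀) = 1` and `φ₂(T₀) = 0` on all
  61 826 ordinary curves (ENGINE 37t): `κ(T₀)` is the canonical ramified generator of the local image, so «generic at 2» = `κ(P) ∉ ⟨κ(T₀)⟩` (B) / `κ(P) = κ(T₀) + étale` (C, D).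
* v3 (same day, ENGINES 37k2 / CHECK 37K3): ES-37R `PrimeLevelReductionDichotomyAtTwo` — the étale functional IS the reduction map: `φ₂(P) = [P mod 2 ∉ 2Ẽ(𝔽₂)]`
  (58 041 / 58 041), so for prime `N`, class B, `Δ < 0`, rank 1: `m_E ≡ 2 (mod 4)` iff `E(ℚ) ↠ Ẽ(𝔽₂) ⊗ ℤ/2`, else `8 ∣ m_E` (409 / 409); the 2-adic depth of `P` in
  `E(ℚ₂)/tors` is NOT the invariant (83 discordant curves = those with `ℚ₂`-rational 4- or 8-torsion).
* v4 — THE ν-LAW (§14): `PrimeLevelNuLawAtTwo` (R as `↔`, 809 / 809), `PrimeLevelRealNuConverseAtTwo` (`m_E ≡ 2 (4)` ⟹ generator on the egg, 710 / 710),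
  `PrimeLevelGaussianRealDepthAtTwo` (`Δ ≡ 1 (4)`, `Δ > 0`, ordinary ⟹ `4 ∣ m_E` at every rank, 465 / 465); bridge to crux idea `modular-degree-mod-four`.
-/

open scoped Classical AddSubgroup

noncomputable section

set_option linter.dupNamespace false
set_option autoImplicit false

namespace Summit.BirchSwinnertonDyer.BirchSwinnertonDyer.Theorems.RankOneAtTwoGaussianNorm

open Literature.NumberTheory.EllipticCurves Literature.NumberTheory.EllipticCurves.ModularForms WeierstrassCurve
open Summit.BirchSwinnertonDyer.Rank1Residual.F1Sign2 (MeetsEgg OnEgg NoRationalTwoTorsion)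

/-! ## Vocabulary repeated verbatim from `RelaxedSelmerFloorES36.lean` v8 (LAW H / LAW P) -/

/-- `x ∈ ℚ` is a square in `ℚ_q`. -/
def IsPadicSquare (q : ℕ) [Fact q.Prime] (x : ℚ) : Prop := IsSquare ((x : ℚ_[q]))

/-- The archimedean even-Tamagawa bit `[c_∞(E) = 2] = [Δ_E > 0]`. -/
def realComponentBit (W : WeierstrassCurve ℚ) : ℕ := if 0 < W.Δ then 1 else 0

/-- Tier β ∪ γ: multiplicative primes `q ∥ N` with `v_q(Δ)` even (⟺ `c_q` even ⟺ `E[2]` unramified at `q`). -/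
def evenTamagawaMultPrimes (W : WeierstrassCurve ℚ) : Finset ℕ :=
  (W.conductorNorm ℤ).primeFactors.filter (fun q => ¬ q ^ 2 ∣ W.conductorNorm ℤ ∧ Even (padicValRat q W.Δ))

/-- Tier γ: multiplicative primes `q ∥ N` with `E[2] ⊂ E(ℚ_q)` (⟺ `c₄Δ ∈ ℚ_q^{×2}`). -/
def fullTwoTorsionMultPrimes (W : WeierstrassCurve ℚ) : Finset ℕ :=
  (W.conductorNorm ℤ).primeFactors.filter (fun q => ¬ q ^ 2 ∣ W.conductorNorm ℤ ∧ ∃ hq : q.Prime, @IsPadicSquare q ⟨hq⟩ (W.c₄ * W.Δ))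

/-- The halving quartic of abscissa `x` has a root in `K ⊇ ℚ`. -/
def HalvingQuarticSolvable (W : WeierstrassCurve ℚ) (K : Type*) [Field K] [CharZero K] (x : ℚ) : Prop :=
  ∃ X : K, X ^ 4 - ((W.b₄ : ℚ) : K) * X ^ 2 - 2 * ((W.b₆ : ℚ) : K) * X - ((W.b₈ : ℚ) : K)
    = ((x : ℚ) : K) * (4 * X ^ 3 + ((W.b₂ : ℚ) : K) * X ^ 2 + 2 * ((W.b₄ : ℚ) : K) * X + ((W.b₆ : ℚ) : K))

/-- `2E(ℚ)` inside the Mordell–Weil group. -/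
def twiceMordellWeil (W : WeierstrassCurve ℚ) : AddSubgroup W.toAffine.Point :=
  ((2 • AddMonoidHom.id W.toAffine.Point : W.toAffine.Point →+ W.toAffine.Point)).range

/-- Split multiplicative reduction at `q`: `−c₄c₆ ∈ ℚ_q^{×2}`. -/
def IsSplitMultAt (W : WeierstrassCurve ℚ) (q : ℕ) [Fact q.Prime] : Prop := IsPadicSquare q (-(W.c₄ * W.c₆))

/-- `(x, y)` is `q`-integral and reduces to the singular point mod `q`. -/
def SingularReductionAt (W : WeierstrassCurve ℚ) (q : ℕ) (x y : ℚ) : Prop :=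
  0 ≤ padicValRat q x ∧
  (2 * y + W.a₁ * x + W.a₃ = 0 ∨ 0 < padicValRat q (2 * y + W.a₁ * x + W.a₃)) ∧
  (3 * x ^ 2 + 2 * W.a₂ * x + W.a₄ - W.a₁ * y = 0 ∨ 0 < padicValRat q (3 * x ^ 2 + 2 * W.a₂ * x + W.a₄ - W.a₁ * y))

/-- `(x, y)` maps to the non-trivial class of `Φ_q/2Φ_q` (non-split: singular reduction; split `I_n`: Silverman's `k = min(v_q(2y+a₁x+a₃), n/2)` odd). -/
def OddComponentAt (W : WeierstrassCurve ℚ) (q : ℕ) [Fact q.Prime] (x y : ℚ) : Prop :=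
  SingularReductionAt W q x y ∧
    (IsSplitMultAt W q → Odd (min (padicValRat q (2 * y + W.a₁ * x + W.a₃)) (padicValRat q W.Δ / 2)))

/-- The Kummer class of abscissa `x` at a tier-γ prime `2` has odd sign `χ₋₄`. -/
def KummerSignOddAtTwo (W : WeierstrassCurve ℚ) (x : ℚ) : Prop :=
  ∃ e : ℚ_[2], 4 * e ^ 3 + (W.b₂ : ℚ_[2]) * e ^ 2 + 2 * (W.b₄ : ℚ_[2]) * e + (W.b₆ : ℚ_[2]) = 0 ∧
    ∃ c ∈ ({-1, -5, -2, -10} : Finset ℚ), IsSquare ((c : ℚ_[2]) * ((x : ℚ_[2]) - e))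

/-- LAW-H absorption at an even-Tamagawa prime `q` (all paying functionals, N- and K-type). -/
def AbsorbedAtH (W : WeierstrassCurve ℚ) (q : ℕ) (x y : ℚ) : Prop :=
  ∀ hq : q.Prime, letI : Fact q.Prime := ⟨hq⟩;
    (q ∈ fullTwoTorsionMultPrimes W →
        (q = 2 → ¬ KummerSignOddAtTwo W x ∧ (¬ IsSplitMultAt W q → ¬ OddComponentAt W q x y)) ∧
        (q ≠ 2 → (IsSplitMultAt W q → q % 4 = 3 → ¬ OddComponentAt W q x y) ∧ (¬ IsSplitMultAt W q → ¬ OddComponentAt W q x y))) ∧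
    (q ∉ fullTwoTorsionMultPrimes W → ¬ IsSplitMultAt W q → ¬ OddComponentAt W q x y)

/-- `P` dies in every LAW-H absorbing quotient `A_v`, `v ∈ S(E)`. -/
def AbsorptionRigidPointH (W : WeierstrassCurve ℚ) (P : W.toAffine.Point) : Prop :=
  ∀ (x y : ℚ) (h : W.toAffine.Nonsingular x y), P = WeierstrassCurve.Affine.Point.some x y h →
    (0 < W.Δ → HalvingQuarticSolvable W ℝ x) ∧ ∀ q ∈ evenTamagawaMultPrimes W, AbsorbedAtH W q x y

/-- `#{c ∈ E(ℚ)/2E(ℚ) : c ↦ 0 in ⊕_{v ∈ S(E)} A_v}` (`= 2^{r − a(E)}`). -/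
def rigidClassCountH (W : WeierstrassCurve ℚ) : ℕ :=
  Nat.card {c : W.toAffine.Point ⧸ twiceMordellWeil W //
    ∃ P : W.toAffine.Point, (QuotientAddGroup.mk P : W.toAffine.Point ⧸ twiceMordellWeil W) = c ∧ AbsorptionRigidPointH W P}

/-- Non-split even-Tamagawa primes. -/
def nonSplitEvenTamagawaPrimes (W : WeierstrassCurve ℚ) : Finset ℕ :=
  (evenTamagawaMultPrimes W).filter (fun q => ∃ hq : q.Prime, ¬ @IsSplitMultAt W q ⟨hq⟩)

/-- `P ↦ 0` in every N-type (component-type) quotient at `q`. -/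
def AbsorbedAtN (W : WeierstrassCurve ℚ) (q : ℕ) (x y : ℚ) : Prop :=
  ∀ hq : q.Prime, letI : Fact q.Prime := ⟨hq⟩;
    ¬ IsSplitMultAt W q → (q ∉ fullTwoTorsionMultPrimes W ∨ q = 2 ∨ q % 4 = 1) → ¬ OddComponentAt W q x y

/-- `P` dies in every N-type quotient. -/
def AbsorptionRigidPointN (W : WeierstrassCurve ℚ) (P : W.toAffine.Point) : Prop :=
  ∀ (x y : ℚ) (h : W.toAffine.Nonsingular x y), P = WeierstrassCurve.Affine.Point.some x y h →
    ∀ q ∈ evenTamagawaMultPrimes W, AbsorbedAtN W q x y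

/-- `#{c ∈ E(ℚ)/2E(ℚ) : c ↦ 0 in ⊕ N-type quotients}`. -/
def rigidClassCountN (W : WeierstrassCurve ℚ) : ℕ :=
  Nat.card {c : W.toAffine.Point ⧸ twiceMordellWeil W //
    ∃ P : W.toAffine.Point, (QuotientAddGroup.mk P : W.toAffine.Point ⧸ twiceMordellWeil W) = c ∧ AbsorptionRigidPointN W P}

/-- `a_N(E) = rk(E(ℚ)/2E(ℚ) → ⊕ N-type quotients)`. -/
def absorptionRankN (W : WeierstrassCurve ℚ) [W.IsElliptic] : ℕ := W.mordellWeilRank - Nat.log 2 (rigidClassCountN W)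

/-- Number of N-type functionals. -/
def nTypeCount (W : WeierstrassCurve ℚ) : ℕ :=
  ((evenTamagawaMultPrimes W).filter (fun q =>
      (∃ hq : q.Prime, ¬ @IsSplitMultAt W q ⟨hq⟩) ∧ (q ∉ fullTwoTorsionMultPrimes W ∨ q = 2 ∨ q % 4 = 1))).card

/-- Number of K-type functionals `[Δ > 0] + #{q ∈ γ(E) : q = 2 ∨ q ≡ 3 (mod 4)}`. -/
def kTypeCount (W : WeierstrassCurve ℚ) : ℕ :=
  realComponentBit W + ((fullTwoTorsionMultPrimes W).filter (fun q => q = 2 ∨ q % 4 = 3)).card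

/-- LAW-P pairing bit `b_P(E) = [#N + a_N(E) odd] · [rk(E(ℚ)/2 → ⊕ N ⊕ K) = a_N(E) + #K]`. -/
def pairingBit (W : WeierstrassCurve ℚ) [W.IsElliptic] : ℕ :=
  if Odd (nTypeCount W + absorptionRankN W) ∧ rigidClassCountN W = 2 ^ kTypeCount W * rigidClassCountH W then 1 else 0

/-! ## ES-37A — LAW GP: the geometric 2-length (REF1 §PG, confirmed by ENGINE 37z on the full family incl. γ₂)

At a multiplicative prime `q ∥ N` with `v_q(Δ)` even the weight is `ord₂ v_q(Δ)` (tier β) resp. `ord₂ v_q(Δ) + 1` (tier γ, split or not, odd or `q = 2`):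
`v_q(Δ) = #Φ_q(𝔽̄_q)` is the 2-primary length visible to the Tate parametrisation (Ribet–Takahashi / Takahashi), larger than `ord₂ c_q = 1` at a NON-split place.
LAW G (weights only): 0 / 431 171, 163 433 tight, strictly above LAW H on 53 085 curves (+1: 36 774, +2: 12 418, +3: 3 249, … +7: 3) with 0 violations;
non-split γ₂ cells with `ord₂ v₂(Δ) = 3 / 4 / 5` (n = 998 / 293 / 57) are attained, so the old weight `2 + [4 ∣ v₂(Δ)]` there was a truncation. -/

/-- The GEOMETRIC Tamagawa 2-length `Σ_{q ∥ N, v_q(Δ) even} ord₂ v_q(Δ)` (`v_q(Δ_min) = #Φ_q(𝔽̄_q)` at a multiplicative prime). -/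
def geometricTwoLength (W : WeierstrassCurve ℚ) : ℕ :=
  ∑ q ∈ evenTamagawaMultPrimes W, padicValNat 2 (padicValRat q W.Δ).natAbs

/-- **ES-37A `GeometricLengthPairingDivisibilityAtTwo` (LAW GP = LAW P with geometric 2-lengths; all optimal semistable curves with `E(ℚ)[2] = 0`, `Δ ∉ ℚ^{×2}`).**
`2^(ω(N) − 1 + [Δ>0] + Σ_{q ∈ β∪γ} ord₂ v_q(Δ) + #γ(E) + b_P(E)) · #{c ∈ E(ℚ)/2E(ℚ) rigid in ⊕_{v∈S} A_v} ∣ m_E`, with LAW H's absorbing quotients and LAW P's pairing bit.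
CENSUS (ENGINE 37z, Cremona `N < 5·10⁵`, 431 171 curves, ranks 0–4; analyzer 37A reproduces LAW P's 156 268 tight exactly before switching weights): **0 exceptions;
179 688 tight (41.7 %; by rank 49 762 / 92 200 / 35 904 / 1 822); cells `(r, sign Δ, place signature with ord₂ v_q(Δ) ≤ 3 resp. uncapped, a_N, a − a_N)`, n ≥ 20:
1 525 / 1 525 resp. 1 540 / 1 540 attained (n ≥ 10: 2 387 / 2 389)**; non-γ₂ sub-family 413 874: 172 621 tight.  Why it might fail: post hoc in the γ₂ weight
(`ord₂ v₂(Δ) + 1` replacing `2 + [4 ∣ v₂(Δ)]`); first out-of-sample range `5·10⁵ ≤ N < 10⁶`; one optimal semistable curve below the floor kills it — cheapest class: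
non-split β prime with `8 ∣ v_q(Δ)` and a generator on the singular component (weight 3, one functional).
[cite: RibetTakahashi1997, Thm. 1] [cite: Takahashi2001, Thm. 2.3] [cite: Watkins2002, Conj. 4.1] [cite: DummiganKrishnamoorthy2013, Prop. 2.1] -/
@[conjecture] def GeometricLengthPairingDivisibilityAtTwo : Prop :=
  ∀ (W : WeierstrassCurve ℚ) [W.IsElliptic] [W.IsGloballyMinimal] [NeZero (W.conductorNorm ℤ)]
    (D : ModularParametrizationData W (W.conductorNorm ℤ)),
    (∀ (W'' : WeierstrassCurve ℚ) [W''.IsElliptic] (D'' : ModularParametrizationData W'' (W.conductorNorm ℤ)),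
        D''.f = D.f → D.modularDegree ≤ D''.modularDegree) →
    Squarefree (W.conductorNorm ℤ) → Nat.card (W.toAffine.Point[(2 : ℤ)]) = 1 → ¬ IsSquare W.Δ →
    2 ^ ((W.conductorNorm ℤ).primeFactors.card - 1 + realComponentBit W + geometricTwoLength W + (fullTwoTorsionMultPrimes W).card
          + pairingBit W) * rigidClassCountH W ∣ D.modularDegree

/-! ## ES-37B / ES-37C — THE GOOD ORDINARY PRIME 2 (odd `N`; ENGINES 37y / 37w / 37v)

2-adic 2-torsion on a minimal model with good ORDINARY reduction at 2: the 2-division cubic `h(Y) = 4Y³ + b₂Y² + 2b₄Y + b₆` factors over `ℚ₂` as `4(Y − e₀)(Y² + pY + q)`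
with exactly one root `e₀ = x(T₀)` of NEGATIVE valuation (`v₂(e₀) = −2`; `T₀` = the 2-torsion point of the formal group = the canonical subgroup; no such root exists at
supersingular 2, where inertia acts on `E[2]` through an element of order 3) and `p, q ∈ ℤ₂` (ENGINE 37y: one odd-unit root `X₀ = 4e₀` of `X³ + b₂X² + 8b₄X + 16b₆` on all
43 917 ordinary odd-`N` curves of rank ≥ 1).  The quadratic factor splits over `ℚ₂` (class D, `E[2] ⊂ E(ℚ₂)`, two `ℤ₂`-roots `e₁, e₂`) iff `Δ ≡ 1 (mod 8)`, has roots in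
`F = ℚ₂(√5)` (class C) iff `Δ ≡ 5 (mod 8)`, in a ramified quadratic field (class B) iff `Δ ≡ 3 (mod 4)`.  Local Kummer data of `P = (x, y) ∈ E(ℚ)`:
`κ_{T₀}(P) = cls(x − e₀) ∈ ℚ₂^×/ℚ₂^{×2}` — always in `{1, 5}` (58 041 / 58 041 generator values: the étale line); `α := x − e₁ ∈ F_v = ℚ₂[Y]/(Y² + pY + q)`, `Tr α = 2x + p`,
`N α = x² + px + q`.  THE TWO FUNCTIONALS: `φ₂(P) := [κ_{T₀}(P) ≠ 1]` (étale, N-type) and `λ₂(P) := [F_v(√α)/F_v ramified]` (Gaussian, K-type; on `E(ℚ₂)`-points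
`= [ℚ₂(½P)/ℚ₂ ramified]`; D: `= [x − e₁ ≡ 3·unit² (mod 4)] = [(−1, x − e₁)₂ = −1]`, the same for `e₂`, 8 628 / 8 628; C: `= s₁` where `u³ ≡ 1 + 2(s₁ + s₂ω) (mod 4)` for the unit
`u = α`, and `s₂ = Tr s = 0`, `v(α) = 0` on all 15 355 values; basis-free: `Tr(α³) − N(α³) ≡ 5 (mod 8)` after normalising `N α` to a unit, 15 355 / 15 355 = ENGINE 37w). -/

/-- `h(Y) = 4Y³ + b₂Y² + 2b₄Y + b₆ = 4(Y − e₀)(Y² + pY + q)` over `ℚ₂` with `‖e₀‖ > 1`: the ORDINARY factorisation at 2 (`e₀ = x(T₀)`, `T₀` the formal-group 2-torsion point). -/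
def OrdinaryFactorAtTwo (W : WeierstrassCurve ℚ) (e₀ p q : ℚ_[2]) : Prop :=
  (∀ Y : ℚ_[2], 4 * Y ^ 3 + (W.b₂ : ℚ_[2]) * Y ^ 2 + 2 * (W.b₄ : ℚ_[2]) * Y + (W.b₆ : ℚ_[2]) = 4 * (Y - e₀) * (Y ^ 2 + p * Y + q)) ∧ 1 < ‖e₀‖

/-- `E` (a minimal model with `2 ∤ N`) is ORDINARY at 2: the 2-division cubic has a `ℚ₂`-root of negative valuation. -/
def IsOrdinaryAtTwo (W : WeierstrassCurve ℚ) : Prop := ∃ e₀ p q : ℚ_[2], OrdinaryFactorAtTwo W e₀ p q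

/-- The GAUSSIAN SIGN at 2 is `+1`: `Δ ≡ 1 (mod 4)`, i.e. `(Δ, −1)₂ = +1`, i.e. `−1` is a norm from `ℚ₂(√Δ) = ℚ₂(E[2] resolvent)`, i.e. (with `2 ∤ N`) `ρ̄_{E,2}` is
UNRAMIFIED at 2 (classes C ∪ D; Kramer's `i₂(χ₋₄) = 2` in the ordinary case). -/
def GaussianSignAtTwo (W : WeierstrassCurve ℚ) : Prop := ∃ m : ℤ, W.Δ = 4 * (m : ℚ) + 1

/-- `φ₂(x) = 1`: the ÉTALE Kummer coordinate of abscissa `x` is non-trivial, `x − e₀ ∉ ℚ₂^{×2}` (on `E(ℚ₂)`: `κ_{T₀}(P) = 5`, i.e. `P ∉ ψ̂E′(ℚ₂)` for the 2-isogeny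
`ψ : E → E′ = E/⟨T₀⟩`). -/
def EtaleKummerOddAtTwo (W : WeierstrassCurve ℚ) (x : ℚ) : Prop :=
  ∃ e₀ p q : ℚ_[2], OrdinaryFactorAtTwo W e₀ p q ∧ ¬ IsSquare ((x : ℚ_[2]) - e₀)

/-- `λ₂(x) = 1`: the GAUSSIAN (K-type) functional at a good ordinary prime 2 — the Kummer class of abscissa `x` in the `T₁`-coordinate is RAMIFIED.
Split quadratic factor (class D): for some 2-adic INTEGRAL 2-torsion abscissa `e` (`e² + pe + q = 0`), `x − e ∈ {−1, −5, −2, −10}·ℚ₂^{×2}` (`(−1, x − e)₂ = −1`);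
irreducible factor (class C, `F = ℚ₂[Y]/(Y² + pY + q)`): with `α = x − Y`, `s = 2^k·Tr α`, `n = 4^k·N α` normalised so that `n` is a unit and `s` is integral,
`Tr(α′³) − N(α′³) = s³ − 3sn − n³ ≡ 5 (mod 8)` (⟺ `α′³ ≢ 1 (mod 4𝒪_F)` ⟺ `F(√α)/F` ramified).  On `E(ℚ₂)`-points both read `[ℚ₂(½P)/ℚ₂ is ramified]`. -/
def GaussianOddAtTwo (W : WeierstrassCurve ℚ) (x : ℚ) : Prop :=
  ∃ e₀ p q : ℚ_[2], OrdinaryFactorAtTwo W e₀ p q ∧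
    ((∃ e : ℚ_[2], e ^ 2 + p * e + q = 0 ∧ ∃ c ∈ ({-1, -5, -2, -10} : Finset ℚ), IsSquare ((c : ℚ_[2]) * ((x : ℚ_[2]) - e))) ∨
     ((¬ ∃ e : ℚ_[2], e ^ 2 + p * e + q = 0) ∧
        ∃ k : ℤ, ‖(4 : ℚ_[2]) ^ k * ((x : ℚ_[2]) ^ 2 + p * x + q)‖ = 1 ∧ ‖(2 : ℚ_[2]) ^ k * (2 * (x : ℚ_[2]) + p)‖ ≤ 1 ∧
          ‖((2 : ℚ_[2]) ^ k * (2 * (x : ℚ_[2]) + p)) ^ 3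
              - 3 * ((2 : ℚ_[2]) ^ k * (2 * (x : ℚ_[2]) + p)) * ((4 : ℚ_[2]) ^ k * ((x : ℚ_[2]) ^ 2 + p * x + q))
              - ((4 : ℚ_[2]) ^ k * ((x : ℚ_[2]) ^ 2 + p * x + q)) ^ 3 - 5‖ ≤ 8⁻¹))

/-- `P` dies in every LAW-H quotient AND in the Gaussian quotient at 2 (`λ₂(P) = 0`). -/
def AbsorptionRigidPointK (W : WeierstrassCurve ℚ) (P : W.toAffine.Point) : Prop :=
  ∀ (x y : ℚ) (h : W.toAffine.Nonsingular x y), P = WeierstrassCurve.Affine.Point.some x y h →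
    (0 < W.Δ → HalvingQuarticSolvable W ℝ x) ∧ (∀ q ∈ evenTamagawaMultPrimes W, AbsorbedAtH W q x y) ∧ ¬ GaussianOddAtTwo W x

/-- `#{c ∈ E(ℚ)/2E(ℚ) : c rigid for S(E) ∪ {2}}` with the Gaussian quotient at 2 (`= 2^{r − a_K(E)}`). -/
def rigidClassCountK (W : WeierstrassCurve ℚ) : ℕ :=
  Nat.card {c : W.toAffine.Point ⧸ twiceMordellWeil W //
    ∃ P : W.toAffine.Point, (QuotientAddGroup.mk P : W.toAffine.Point ⧸ twiceMordellWeil W) = c ∧ AbsorptionRigidPointK W P}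

/-- LAW-K pairing bit: LAW P's bit with the prime 2 counted as one more K-type place (`#K + 1`; rigid count for N ∪ K ∪ {λ₂}`). -/
def pairingBitK (W : WeierstrassCurve ℚ) [W.IsElliptic] : ℕ :=
  if Odd (nTypeCount W + absorptionRankN W) ∧ rigidClassCountN W = 2 ^ (kTypeCount W + 1) * rigidClassCountK W then 1 else 0

/-- **ES-37B `GaussianNormDivisibilityAtTwo` (LAW K).**  For an optimal semistable `E/ℚ` with ODD conductor, `E(ℚ)[2] = 0`, `Δ ∉ ℚ^{×2}`, ORDINARY at 2 and `Δ ≡ 1 (mod 4)`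
(`(Δ,−1)₂ = +1`, `ρ̄_{E,2}` unramified at 2): the good prime 2 is a K-type place of weight ONE with the Gaussian functional `λ₂`:
`2^(ω(N) − 1 + [Δ>0] + Σ_{q∈β∪γ} ord₂ v_q(Δ) + #γ + 1 + b_K(E)) · #{c ∈ E(ℚ)/2E(ℚ) : c rigid in ⊕_{v ∈ S} A_v ⊕ A₂}, A₂ = ⟨λ₂⟩ ∣ m_E`.
Readings: rank 0 ⟹ `v₂(m_E) ≥ ω − 1 + τ_G + 1`; rank 1 with `ℚ₂(½P)` ramified for the generator ⟹ the 2-direction is paid (floor as LAW GP + the K-place in the bit);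
rank 1 with `P ∈ 2E(ℚ₂^{nr})` ⟹ one power of 2 more than LAW GP.
CENSUS (ENGINES 37y/37w/37v + 37z, Cremona `N < 5·10⁵`): **26 201 curves (Δ ≡ 5 (8): 16 457; Δ ≡ 1 (8): 9 744), 0 exceptions; tight 6 193 + 3 294 (LAW GP on the same curves:
2 413 + 1 476; rank-0 tightness 31.1 % / 26.3 % vs 4.0 % / 3.0 %); fine cells `(r, signΔ, signature, a_N, a_K)` n ≥ 20: r ≥ 1: 78/78 + 45/45, r = 0: 30/30 + 18/18 attained (GP: 46/78,
28/45; 8/30, 6/18)**; pointwise ≥ LAW GP.  Witnesses at the new floor: 139a1, 307b1 (C, r = 0, prime level: `2 ∥ m_E` from the prime 2 alone), 503b1, 2071a1, 2089c1 (D; Kilford's and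
Ribet–Stein's non-Gorenstein levels), 331a1, 731a1 (C, r = 1, generator unramified at 2: `4 ∣ m_E`).  Controls: weight 2 (Kramer's full index `i₂ = 2`) refuted by 2 325 rank-0
curves; typing 2 as an N-type (parity-only) place with the same functional `λ₂`: 0 violations but tight only 632 + 1 388 (C, r = 0 / r ≥ 1) and 433 + 762 (D) against
1 502 + 4 691 and 823 + 2 471; any functional of `κ_{T₀}` alone at Δ ≡ 5 (8): ≥ 4 cells missed; `(−1, N_{F/ℚ₂} α)₂`: fails (it factors
through `κ_{T₀}`).  First rung in print: prime `N`, rank 0 ⟹ `2 ∣ m_E` for ordinary `E` [cite: CalegariEmerton2009, Thm. 1]; multiplicity one fails exactly at Δ ≡ 1 (8)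
[cite: KilfordWiese2008, Thm. 1.2–1.3] yet the floor is the same at Δ ≡ 5 (8).  Why it might fail: found by a functional fit on this range (pre-registered only as «absorption
at 2 exists», P37.12); the first out-of-sample range and the thin cells decide; ONE curve below the floor kills it — cheapest class: rank 1, Δ ≡ 5 (8), Δ < 0, no even
Tamagawa prime, generator with `F(√α)/F` unramified, at `v₂(m_E) = ω` (973 such curves: 0 there, 339 at `ω + 1`; of the 1 226 with `λ₂(P) = 1`, 434 sit at `ω`).
[cite: Kramer1981, Prop. 6 and Cor. 1] [cite: CalegariEmerton2009, Thm. 1] [cite: KilfordWiese2008, Thm. 1.3] [cite: Watkins2002, Conj. 4.1] [cite: RibetTakahashi1997, Thm. 1] -/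
@[conjecture] def GaussianNormDivisibilityAtTwo : Prop :=
  ∀ (W : WeierstrassCurve ℚ) [W.IsElliptic] [W.IsGloballyMinimal] [NeZero (W.conductorNorm ℤ)]
    (D : ModularParametrizationData W (W.conductorNorm ℤ)),
    (∀ (W'' : WeierstrassCurve ℚ) [W''.IsElliptic] (D'' : ModularParametrizationData W'' (W.conductorNorm ℤ)),
        D''.f = D.f → D.modularDegree ≤ D''.modularDegree) →
    Squarefree (W.conductorNorm ℤ) → ¬ 2 ∣ W.conductorNorm ℤ → IsOrdinaryAtTwo W → GaussianSignAtTwo W →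
    Nat.card (W.toAffine.Point[(2 : ℤ)]) = 1 → ¬ IsSquare W.Δ →
    2 ^ ((W.conductorNorm ℤ).primeFactors.card - 1 + realComponentBit W + geometricTwoLength W + (fullTwoTorsionMultPrimes W).card + 1
          + pairingBitK W) * rigidClassCountK W ∣ D.modularDegree

/-- **ES-37B₀ `GaussianNormDivisibilityAtTwoRankZero`** — the Mordell–Weil-free shadow of LAW K: same hypotheses ⟹ `2^(ω(N) + [Δ>0] + Σ ord₂ v_q(Δ) + #γ) ∣ m_E`
(the `−1` of Atkin–Lehner and the `+1` of the prime 2 cancel).  At PRIME level with no even Tamagawa place this reads `2^{1 + [Δ>0]} ∣ m_E`: the first factor is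
Calegari–Emerton's theorem (odd `m_E` forces supersingular reduction when `E(ℚ)[2] = 0`, `N` odd prime), the second (`4 ∣ m_E` when `Δ > 0`) is new: 1 139 / 1 139 rank-0 curves
with `Δ > 0`, no even Tamagawa prime, `Δ ≡ 1 (4)`, ordinary, have `v₂(m_E) ≥ ω + 1` (0 at `ω`).  CENSUS rank 0: 7 966 / 7 966, 2 325 tight.
[cite: CalegariEmerton2009, Thm. 1] [cite: KilfordWiese2008, §1.1] [cite: Watkins2002, Conj. 4.1] -/
@[conjecture] def GaussianNormDivisibilityAtTwoRankZero : Prop :=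
  ∀ (W : WeierstrassCurve ℚ) [W.IsElliptic] [W.IsGloballyMinimal] [NeZero (W.conductorNorm ℤ)]
    (D : ModularParametrizationData W (W.conductorNorm ℤ)),
    (∀ (W'' : WeierstrassCurve ℚ) [W''.IsElliptic] (D'' : ModularParametrizationData W'' (W.conductorNorm ℤ)),
        D''.f = D.f → D.modularDegree ≤ D''.modularDegree) →
    Squarefree (W.conductorNorm ℤ) → ¬ 2 ∣ W.conductorNorm ℤ → IsOrdinaryAtTwo W → GaussianSignAtTwo W →
    Nat.card (W.toAffine.Point[(2 : ℤ)]) = 1 → ¬ IsSquare W.Δ →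
    2 ^ ((W.conductorNorm ℤ).primeFactors.card - 1 + realComponentBit W + geometricTwoLength W + (fullTwoTorsionMultPrimes W).card + 1) ∣ D.modularDegree

/-- ES-37B ⟹ ES-37B₀ (drop the pairing bit and the class-count factor; no rank hypothesis is needed for this direction). -/
theorem gaussianNormRankZero_of_gaussianNorm (h : GaussianNormDivisibilityAtTwo) : GaussianNormDivisibilityAtTwoRankZero := by
  intro W _ _ _ D hopt hsf h2 hord hsgn ht2 hsq
  have h' := h W D hopt hsf h2 hord hsgn ht2 hsq
  exact dvd_trans (dvd_trans (pow_dvd_pow 2 (Nat.le_add_right _ _)) (dvd_mul_right _ _)) h'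

/-- `P` dies in every N-type quotient AND in the étale quotient at 2 (`φ₂(P) = 0`). -/
def AbsorptionRigidPointNEt (W : WeierstrassCurve ℚ) (P : W.toAffine.Point) : Prop :=
  ∀ (x y : ℚ) (h : W.toAffine.Nonsingular x y), P = WeierstrassCurve.Affine.Point.some x y h →
    (∀ q ∈ evenTamagawaMultPrimes W, AbsorbedAtN W q x y) ∧ ¬ EtaleKummerOddAtTwo W x

/-- `P` dies in every LAW-H quotient AND in the étale quotient at 2. -/
def AbsorptionRigidPointHEt (W : WeierstrassCurve ℚ) (P : W.toAffine.Point) : Prop :=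
  ∀ (x y : ℚ) (h : W.toAffine.Nonsingular x y), P = WeierstrassCurve.Affine.Point.some x y h →
    (0 < W.Δ → HalvingQuarticSolvable W ℝ x) ∧ (∀ q ∈ evenTamagawaMultPrimes W, AbsorbedAtH W q x y) ∧ ¬ EtaleKummerOddAtTwo W x

/-- `#{c ∈ E(ℚ)/2E(ℚ) : c rigid for the N-type quotients and φ₂}`. -/
def rigidClassCountNEt (W : WeierstrassCurve ℚ) : ℕ :=
  Nat.card {c : W.toAffine.Point ⧸ twiceMordellWeil W //
    ∃ P : W.toAffine.Point, (QuotientAddGroup.mk P : W.toAffine.Point ⧸ twiceMordellWeil W) = c ∧ AbsorptionRigidPointNEt W P}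

/-- `#{c ∈ E(ℚ)/2E(ℚ) : c rigid for all LAW-H quotients and φ₂}`. -/
def rigidClassCountHEt (W : WeierstrassCurve ℚ) : ℕ :=
  Nat.card {c : W.toAffine.Point ⧸ twiceMordellWeil W //
    ∃ P : W.toAffine.Point, (QuotientAddGroup.mk P : W.toAffine.Point ⧸ twiceMordellWeil W) = c ∧ AbsorptionRigidPointHEt W P}

/-- `a_{N∪{2}}(E) = rk(E(ℚ)/2 → ⊕ N-type quotients ⊕ ⟨φ₂⟩)`. -/
def absorptionRankNEt (W : WeierstrassCurve ℚ) [W.IsElliptic] : ℕ := W.mordellWeilRank - Nat.log 2 (rigidClassCountNEt W)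

/-- LAW-Et pairing bit: LAW P's bit with the prime 2 ADJOINED as an N-type place (`#N + 1`, `a_N` and the independence test computed with `φ₂` included; `φ₂` absorbs nothing). -/
def pairingBitEt (W : WeierstrassCurve ℚ) [W.IsElliptic] : ℕ :=
  if Odd (nTypeCount W + 1 + absorptionRankNEt W) ∧ rigidClassCountNEt W = 2 ^ kTypeCount W * rigidClassCountHEt W then 1 else 0

/-- **ES-37C `EtaleParityDivisibilityAtTwo` (LAW Et).**  For an optimal semistable `E/ℚ` with ODD conductor, `E(ℚ)[2] = 0`, `Δ ∉ ℚ^{×2}`, ORDINARY at 2 (classes B ∪ C ∪ D):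
LAW GP ALSO holds with the prime 2 adjoined to the place set as an N-type place of weight 0 whose functional is the étale Kummer coordinate `φ₂`:
`2^(ω(N) − 1 + [Δ>0] + Σ_{q∈β∪γ} ord₂ v_q(Δ) + #γ + b_Et(E)) · #{c rigid in ⊕_{v∈S} A_v} ∣ m_E`.
Rank-0 reading: `b_Et = [#N even ∧ #K = 0]`, so together with LAW GP (`[#N odd ∧ #K = 0]`) an ordinary rank-0 curve with no K-type place sits at `≥ ω − 1 + τ_G + 1` — at prime level
Calegari–Emerton's evenness for ordinary curves with `Δ < 0`, incl. class B (`ρ̄` ordinary, complex, ramified at 2).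
CENSUS (ENGINE 37y + 37z, Cremona `N < 5·10⁵`): **61 826 ordinary odd-`N` curves, 0 exceptions (B 35 625: 13 706 tight vs GP 11 599, cells `(r, signΔ, signature, a_N, a_K)` n ≥ 20: Et alone attains 158 / 175,
GP alone 152 / 175, GP ∧ Et together 175 / 175; C 16 457, D 9 744: 0 exceptions, strictly above LAW K on 717 + 579 curves)**.  Witnesses: 329a1, 1169a1, 1941a1 (B, r = 0, prime level),
1185b1/c1, 2919a1, 3927b1 (B, composite), 3803a1, 8071a1 (C/D, r = 1, above LAW K).  Controls: the zero functional in place of `φ₂`: 7 723 / 1 756 / 1 141 violations (B/C/D, r ≥ 1);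
the same adjunction on SUPERSINGULAR curves: 5 152 violations at rank 0 — the étale line exists only at ordinary 2.  Why it might fail: post hoc («Bmax» fit); it is the disjunction
partner of LAW GP, so a rank-0 class-B curve with `Δ < 0`, no N- or K-type place and ODD `m_E·2^{−(ω−1+τ_G)}` kills it (4 616 such curves, all at `≥ +1`).
[cite: CalegariEmerton2009, Thm. 1, §3.4] [cite: Kramer1981, Prop. 6] [cite: Watkins2002, Conj. 4.1] [cite: DummiganKrishnamoorthy2013, Prop. 2.1] -/
@[conjecture] def EtaleParityDivisibilityAtTwo : Prop :=
  ∀ (W : WeierstrassCurve ℚ) [W.IsElliptic] [W.IsGloballyMinimal] [NeZero (W.conductorNorm ℤ)]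
    (D : ModularParametrizationData W (W.conductorNorm ℤ)),
    (∀ (W'' : WeierstrassCurve ℚ) [W''.IsElliptic] (D'' : ModularParametrizationData W'' (W.conductorNorm ℤ)),
        D''.f = D.f → D.modularDegree ≤ D''.modularDegree) →
    Squarefree (W.conductorNorm ℤ) → ¬ 2 ∣ W.conductorNorm ℤ → IsOrdinaryAtTwo W →
    Nat.card (W.toAffine.Point[(2 : ℤ)]) = 1 → ¬ IsSquare W.Δ →
    2 ^ ((W.conductorNorm ℤ).primeFactors.card - 1 + realComponentBit W + geometricTwoLength W + (fullTwoTorsionMultPrimes W).card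
          + pairingBitEt W) * rigidClassCountH W ∣ D.modularDegree

/-- **ES-37 `GaussianFloorAtTwo` (LAW M) — the cell's typed candidate: the three one-sided laws hold simultaneously (the 2-adic floor of `m_E` is their maximum).**
CENSUS: 0 / 431 171; 188 758 tight (43.8 %); all 1 525 + 2 015 populated cells attained; the max is realised by GP on 403 599 curves, by K on 16 231, by Et on 11 341. -/
@[conjecture] def GaussianFloorAtTwo : Prop :=
  GeometricLengthPairingDivisibilityAtTwo ∧ GaussianNormDivisibilityAtTwo ∧ EtaleParityDivisibilityAtTwo

theorem geometricLength_of_floor (h : GaussianFloorAtTwo) : GeometricLengthPairingDivisibilityAtTwo := h.1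
theorem gaussianNorm_of_floor (h : GaussianFloorAtTwo) : GaussianNormDivisibilityAtTwo := h.2.1
theorem etaleParity_of_floor (h : GaussianFloorAtTwo) : EtaleParityDivisibilityAtTwo := h.2.2
theorem gaussianNormRankZero_of_floor (h : GaussianFloorAtTwo) : GaussianNormDivisibilityAtTwoRankZero :=
  gaussianNormRankZero_of_gaussianNorm h.2.1

/-! ## ES-37P — PRIME LEVEL: A KUMMER RECIPROCITY FOR `v₂(m_E)` (ENGINES 37s / 37t; tables `an37_P*`, `an37_R`, `an37_S*`; CensusES37 §12; MEMO-es §37.8)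

At PRIME level `N` (`ω = 1`, no Atkin–Lehner and no Tamagawa place) the floor places of LAW M are `∞` (iff `Δ > 0`) and the good ordinary prime 2, and `v₂(m_E)` is the
2-length of the congruence module of `f_E` (Ribet; Agashe–Ribet–Stein).  On the 12 349 prime-level curves of the P36 family (`N < 5·10⁵`) LAW M is not only a floor:
**in six of the eight `(reduction class at 2) × (sign Δ)` cells the floor is ATTAINED EXACTLY when the Mordell–Weil generator is generic at every floor place**
(`λ_∞(P) = 1`, `φ₂(P) = 1`, and `λ₂(P) = 1` where defined) — 862 / 862 rank-1 curves with `Ш_an = 1` (cells A⁺ 330, B⁻ 270, B⁺ 106, C⁻ 69, C⁺ 31 (value 2), D⁻ 56); the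
two inert cells are Calegari–Emerton's `(supersingular, Δ < 0)` (`𝕋_𝔪 = ℤ₂` possible) and Kilford–Wiese's `(Δ ≡ 1 (8), Δ > 0)` (`N ≡ 1 (8)`, multiplicity one fails).
Conversely a NON-generic generator, or even rank, pushes `v₂(m_E)` up by 2, not 1, in the ramified cells (`Q1`–`Q3` below): the local defect enters SQUARED, as an index does
in a Gross–Zagier / BSD formula.  ES-lens reading: Calegari–Emerton (§3.4) deform `ρ̄` to `GL₂(𝔽₂[x]/x²)` in the direction of the Gaussian character `χ₄` (`H = L(√−1)`);
ES-37P says the `χ₄`-deformation of `f_E` lifts beyond `𝔽₂[x]/x²` iff the Kummer class of the generator is special at 2 (or at `∞`) — congruence depth at 2 ↔ local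
position of the global point, the shape of an explicit reciprocity law at `p = 2`.  Nothing here is in print: Watkins records «no apparent pattern in 2-divisibility
beyond» the Neumann–Setzer parity rules (curves WITH 2-torsion), Calegari–Emerton decide only the parity of `m_E`, Kedlaya–Medvedovsky bound `dim S₂(N)_𝔪`, not the
congruence depth, and none of them sees `a_N` (even vs. odd rank), which ES-37P does. -/

/-- **ES-37P·Q1 `PrimeLevelRamifiedEvenDepthAtTwo`** (Mordell–Weil-free).  `N` an odd prime, `E` optimal, `E(ℚ)[2] = 0`, `Δ < 0`, `Δ ≡ 3 (mod 4)` (class B: ordinary,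
`ρ̄_{E,2}` ramified at 2, complex; then `N ≡ 1 (mod 4)`), SPLIT multiplicative at `N` (`a_N = +1` ⟺ root number `+1` ⟺ even analytic rank) ⟹ `4 ∣ m_E`.
Calegari–Emerton give `2 ∣ m_E` here; LAW M gives `2 ∣ m_E`.  CENSUS (prime `N < 5·10⁵`): 425 / 425 (rank 0: 259 — `v₂(m_E) ∈ {2: 130, 3: 68, 4: 38, ≥5: 23}`, none at 1;
rank 2: 166; `N ≡ 1 (8)`: 207, `N ≡ 5 (8)`: 218); smallest 109a1, 1373a1 (`v₂ = 2`), 1297a1 (`3`).  At composite level the extra factor is absorbed by Atkin–Lehner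
(`ω = 2, 3`: 256 and 665 class-B rank-0 curves sit exactly at the LAW-M floor).  Why it might fail: one optimal curve of prime conductor in this class with `m_E ≡ 2 (mod 4)`.
[cite: CalegariEmerton2009, Thm. 1, §3.4] [cite: Watkins2002, §4.2] [cite: KedlayaMedvedovsky2019, Conj. 13] -/
@[conjecture] def PrimeLevelRamifiedEvenDepthAtTwo : Prop :=
  ∀ (W : WeierstrassCurve ℚ) [W.IsElliptic] [W.IsGloballyMinimal] [NeZero (W.conductorNorm ℤ)]
    (D : ModularParametrizationData W (W.conductorNorm ℤ)),
    (∀ (W'' : WeierstrassCurve ℚ) [W''.IsElliptic] (D'' : ModularParametrizationData W'' (W.conductorNorm ℤ)),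
        D''.f = D.f → D.modularDegree ≤ D''.modularDegree) →
    (hN : (W.conductorNorm ℤ).Prime) → ¬ 2 ∣ W.conductorNorm ℤ →
    Nat.card (W.toAffine.Point[(2 : ℤ)]) = 1 → W.Δ < 0 → (∃ m : ℤ, W.Δ = 4 * (m : ℚ) + 3) →
    @IsSplitMultAt W (W.conductorNorm ℤ) ⟨hN⟩ → 4 ∣ D.modularDegree

/-- **ES-37P·Q2 `PrimeLevelSupersingularEvenGapAtTwo`** (Mordell–Weil-free).  `N` an odd prime, `E` optimal, SUPERSINGULAR at 2 (then `Δ ≡ 5 (mod 8)`, `E(ℚ₂)[2] = 0`),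
`Δ < 0` (Calegari–Emerton's cell (3b): `m_E` may be odd; here `N ≡ 3 (mod 8)` on all 584 rank-0 curves), split at `N` ⟹ `m_E` is odd or `4 ∣ m_E` — never `2 ∥ m_E`.
CENSUS: rank 0: 517 odd + 67 with `4 ∣` + 0 with `2 ∥` (584); rank 2: 295, all `4 ∣`; smallest even ones 571a1 (`v₂ = 3`), 6451a1 (`2`).  (Rank 1, same class: `v₂ = 1` on
375 / 784 — the gap is an even-parity phenomenon.)  Why it might fail: a prime-conductor optimal curve, supersingular at 2, `Δ < 0`, `a_N = +1`, with `m_E ≡ 2 (mod 4)`.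
[cite: CalegariEmerton2009, Thm. 1 (3b), Thm. 7] [cite: Watkins2002, Conj. 4.2] -/
@[conjecture] def PrimeLevelSupersingularEvenGapAtTwo : Prop :=
  ∀ (W : WeierstrassCurve ℚ) [W.IsElliptic] [W.IsGloballyMinimal] [NeZero (W.conductorNorm ℤ)]
    (D : ModularParametrizationData W (W.conductorNorm ℤ)),
    (∀ (W'' : WeierstrassCurve ℚ) [W''.IsElliptic] (D'' : ModularParametrizationData W'' (W.conductorNorm ℤ)),
        D''.f = D.f → D.modularDegree ≤ D''.modularDegree) →
    (hN : (W.conductorNorm ℤ).Prime) → ¬ 2 ∣ W.conductorNorm ℤ → ¬ IsOrdinaryAtTwo W →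
    Nat.card (W.toAffine.Point[(2 : ℤ)]) = 1 → W.Δ < 0 →
    @IsSplitMultAt W (W.conductorNorm ℤ) ⟨hN⟩ → (Odd D.modularDegree ∨ 4 ∣ D.modularDegree)

/-- **ES-37P·R `PrimeLevelKummerReciprocityAtTwo` — the EXACT law.**  `N` an odd prime, `E` optimal, `E(ℚ)[2] = 0`, `Δ < 0`, ORDINARY at 2, `rank E(ℚ) = 1`, and some (equivalently
every) `P ∈ E(ℚ) ∖ 2E(ℚ)` GENERIC at 2: `φ₂(P) = 1` (étale Kummer coordinate `x(P) − e₀ ∉ ℚ₂^{×2}`), and `λ₂(P) = 1` (`ℚ₂(½P)/ℚ₂` ramified) when `Δ ≡ 1 (mod 4)` ⟹ `m_E ≡ 2 (mod 4)`: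
`v₂(m_E) = 1` EXACTLY (LAW M gives `≥ 1`; the content is the upper bound — no congruence of `f_E` modulo 4 or with two companions).  CENSUS: 395 / 395 (class B 270 — 269 with
`Ш_an = 1`, one with `Ш_an = 9` —, C 69, D 56; 0 exceptions; smallest 53a1, 61a1, 89a1 (B), 83a1, 6011a1 (C), 431a1, 503a1 (D)); the unconditioned cells spread over `v₂ ∈ {1,…,≥5}`
(B: 409 curves `{1: 270, 3: 64, ≥4: 75}`).  No `Ш` hypothesis is needed in range (the 5 curves with `Ш_an = 4` in these cells all have a non-generic generator); the `Δ > 0` twin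
(`PrimeLevelRealReciprocityAtTwo`) does need one.  Why it might fail: a generic-generator curve with `Ш(E)[2] ≠ 0` (expected to add ≥ 2) — the statement bets none exists with `Δ < 0`;
cheapest kill otherwise: any curve 53a1-like with `4 ∣ m_E`.
[cite: CalegariEmerton2009, §3.4] [cite: KilfordWiese2008, Thm. 1.2] [cite: Watkins2002, Conj. 4.1] [cite: GrossZagier1986, V.2] -/
@[conjecture] def PrimeLevelKummerReciprocityAtTwo : Prop :=
  ∀ (W : WeierstrassCurve ℚ) [W.IsElliptic] [W.IsGloballyMinimal] [NeZero (W.conductorNorm ℤ)]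
    (D : ModularParametrizationData W (W.conductorNorm ℤ)),
    (∀ (W'' : WeierstrassCurve ℚ) [W''.IsElliptic] (D'' : ModularParametrizationData W'' (W.conductorNorm ℤ)),
        D''.f = D.f → D.modularDegree ≤ D''.modularDegree) →
    (W.conductorNorm ℤ).Prime → ¬ 2 ∣ W.conductorNorm ℤ → IsOrdinaryAtTwo W →
    Nat.card (W.toAffine.Point[(2 : ℤ)]) = 1 → W.Δ < 0 → W.mordellWeilRank = 1 →
    ∀ (x y : ℚ) (h : W.toAffine.Nonsingular x y), WeierstrassCurve.Affine.Point.some x y h ∉ twiceMordellWeil W →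
      EtaleKummerOddAtTwo W x → (GaussianSignAtTwo W → GaussianOddAtTwo W x) → D.modularDegree % 4 = 2

/-- **ES-37P·Q3 `PrimeLevelEtaleDefectAtTwo`** — the complement of R in class B: `N` an odd prime, `E` optimal, `E(ℚ)[2] = 0`, `Δ < 0`, `Δ ≡ 3 (mod 4)`, rank 1, and the
generator SPECIAL at 2 (`φ₂(P) = 0`: `P ∈ ⟨T₀⟩ + 2E(ℚ₂)`) ⟹ `8 ∣ m_E` (LAW M gives `4 ∣`; the defect costs 2, not 1).  CENSUS: 139 / 139 (`v₂ ∈ {3: 64, 4: 34, ≥5: 41}`; of these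
65 have `P ∈ 2E(ℚ₂)` and 74 have `P ∈ T₀ + 2E(ℚ₂)` — same law, ENGINE 37s); smallest 797a1 (`v₂ = 3`), 5653a1 (`4`).  With R and Q1: in class B with `Δ < 0` at prime level,
`v₂(m_E) = 1 ⟺ (a_N = −1 ∧ φ₂(P) = 1)`, else `v₂(m_E) ≥ 2 + [a_N = −1]` (834 curves).  Why it might fail: one such curve with `m_E ≡ 4 (mod 8)`; composite level refutes the
analogue (120 class-B `ω = 2` curves sit at the LAW-M floor with `φ₂(P) = 0`).
[cite: CalegariEmerton2009, §3.4] [cite: Watkins2002, Conj. 4.1] -/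
@[conjecture] def PrimeLevelEtaleDefectAtTwo : Prop :=
  ∀ (W : WeierstrassCurve ℚ) [W.IsElliptic] [W.IsGloballyMinimal] [NeZero (W.conductorNorm ℤ)]
    (D : ModularParametrizationData W (W.conductorNorm ℤ)),
    (∀ (W'' : WeierstrassCurve ℚ) [W''.IsElliptic] (D'' : ModularParametrizationData W'' (W.conductorNorm ℤ)),
        D''.f = D.f → D.modularDegree ≤ D''.modularDegree) →
    (W.conductorNorm ℤ).Prime → ¬ 2 ∣ W.conductorNorm ℤ →
    Nat.card (W.toAffine.Point[(2 : ℤ)]) = 1 → W.Δ < 0 → (∃ m : ℤ, W.Δ = 4 * (m : ℚ) + 3) → W.mordellWeilRank = 1 →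
    ∀ (x y : ℚ) (h : W.toAffine.Nonsingular x y), WeierstrassCurve.Affine.Point.some x y h ∉ twiceMordellWeil W →
      ¬ EtaleKummerOddAtTwo W x → 8 ∣ D.modularDegree

/-- **ES-37P·R⁺ `PrimeLevelRealReciprocityAtTwo`** — the `Δ > 0` twin of R in the cells where `ρ̄_{E,2}` is RAMIFIED at 2 (supersingular, or `Δ ≡ 3 (mod 4)`): `N` an odd prime,
`E` optimal, `E(ℚ)[2] = 0`, `0 < Δ ∉ ℚ^{×2}`, rank 1, `P ∈ E(ℚ) ∖ 2E(ℚ)` with `λ_∞(P) = 1` (`P ∉ E⁰(ℝ)`: the halving quartic has no real root) and, if ordinary, `φ₂(P) = 1`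
⟹ `v₂(m_E) ∈ {1} ∪ [3, ∞)` (`m_E ≡ 2 (mod 4)` or `8 ∣ m_E`).  CENSUS: 447 / 447: `v₂(m_E) = 1` on all 436 with `Ш_an = 1` (supersingular 330 — 37a1, 101a1, 197a1 —, class B
106 — 79a1, 443b1, 659a1), and the 11 curves with `Ш_an = 4` sit at `v₂ ∈ {3,4,5,6}` (201389a1, 484151a1, 136223a1 at 3; 281189a1, 339517b1, 300331a1 at 4; 45979a1, 104239a1,
228581c1 at 5; 228581b1, 104239b1 at 6): the sharp reading is `Ш(E)[2] = 0 ⟹ v₂(m_E) = 1`, which the tree cannot yet phrase.  Not rigid: `(Δ ≡ 5 (8) ordinary, Δ > 0)` is rigid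
at the value 2 (31 / 31) and `(Δ ≡ 1 (8), Δ > 0)` is inert (22 generic curves at `v₂ ∈ {3, 4}`, floor 2) — both excluded here.  Why it might fail: a generic curve with
`Ш_an = 4` and `v₂(m_E) = 2`… is excluded by the census but `Ш[2] ≅ (ℤ/2)²` «should» cost exactly 2, and 8 of the 11 cost more: the mechanism is not understood.
[cite: CalegariEmerton2009, Thm. 1] [cite: Watkins2002, Conj. 4.1] [cite: KilfordWiese2008, Thm. 1.3] -/
@[conjecture] def PrimeLevelRealReciprocityAtTwo : Prop :=
  ∀ (W : WeierstrassCurve ℚ) [W.IsElliptic] [W.IsGloballyMinimal] [NeZero (W.conductorNorm ℤ)]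
    (D : ModularParametrizationData W (W.conductorNorm ℤ)),
    (∀ (W'' : WeierstrassCurve ℚ) [W''.IsElliptic] (D'' : ModularParametrizationData W'' (W.conductorNorm ℤ)),
        D''.f = D.f → D.modularDegree ≤ D''.modularDegree) →
    (W.conductorNorm ℤ).Prime → ¬ 2 ∣ W.conductorNorm ℤ →
    Nat.card (W.toAffine.Point[(2 : ℤ)]) = 1 → 0 < W.Δ → ¬ IsSquare W.Δ → ¬ (IsOrdinaryAtTwo W ∧ GaussianSignAtTwo W) → W.mordellWeilRank = 1 →
    ∀ (x y : ℚ) (h : W.toAffine.Nonsingular x y), WeierstrassCurve.Affine.Point.some x y h ∉ twiceMordellWeil W →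
      ¬ HalvingQuarticSolvable W ℝ x → (IsOrdinaryAtTwo W → EtaleKummerOddAtTwo W x) → (D.modularDegree % 4 = 2 ∨ 8 ∣ D.modularDegree)

/-- **ES-37P `PrimeLevelReciprocityAtTwo`** — the prime-level packet (Q1 ∧ Q2 ∧ R ∧ Q3 ∧ R⁺): 425 + 879 + 395 + 139 + 447 = 2 285 prime-level instances, 0 exceptions. -/
@[conjecture] def PrimeLevelReciprocityAtTwo : Prop :=
  PrimeLevelRamifiedEvenDepthAtTwo ∧ PrimeLevelSupersingularEvenGapAtTwo ∧ PrimeLevelKummerReciprocityAtTwo ∧ PrimeLevelEtaleDefectAtTwo ∧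
    PrimeLevelRealReciprocityAtTwo

theorem ramifiedEvenDepth_of_primeLevel (h : PrimeLevelReciprocityAtTwo) : PrimeLevelRamifiedEvenDepthAtTwo := h.1
theorem supersingularEvenGap_of_primeLevel (h : PrimeLevelReciprocityAtTwo) : PrimeLevelSupersingularEvenGapAtTwo := h.2.1
theorem kummerReciprocity_of_primeLevel (h : PrimeLevelReciprocityAtTwo) : PrimeLevelKummerReciprocityAtTwo := h.2.2.1
theorem etaleDefect_of_primeLevel (h : PrimeLevelReciprocityAtTwo) : PrimeLevelEtaleDefectAtTwo := h.2.2.2.1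
theorem realReciprocity_of_primeLevel (h : PrimeLevelReciprocityAtTwo) : PrimeLevelRealReciprocityAtTwo := h.2.2.2.2

/-- R pins the 2-adic valuation: under its hypotheses `2 ∣ m_E` and `¬ 4 ∣ m_E`. -/
theorem two_dvd_not_four_dvd_of_mod_four_eq_two {m : ℕ} (hm : m % 4 = 2) : 2 ∣ m ∧ ¬ 4 ∣ m := by
  constructor
  · omega
  · omega


/-! ## ES-37R — THE ÉTALE FUNCTIONAL IS THE REDUCTION MAP (v3 addendum, CensusES37 §13)

CHECK 37K3 (58 041 / 58 041 generator values, all ordinary odd-squarefree-`N` curves with `E(ℚ)[2] = 0`, `r ≥ 1`): `EtaleKummerOddAtTwo W x(P)`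
(`x(P) − e₀ ∉ ℚ₂^{×2}`) **coincides with** `[P mod 2 ∉ 2Ẽ(𝔽₂)]` = `[P ∉ E₁(ℚ₂) + 2E(ℚ₂)]` (descent via the 2-isogeny `ψ̂ : E′ = E/⟨T₀⟩ → E`:
`ker(P ↦ x(P) − e₀) = ψ̂E′(ℚ₂) = E₁(ℚ₂) + 2E(ℚ₂)`, both of index `2 = #Ẽ(𝔽₂)/2Ẽ(𝔽₂)`).  So the exact prime-level law R/Q3 reads, with no Kummer theory in the statement:
**`N` prime, `Δ ≡ 3 (mod 4)`, `Δ < 0`, rank 1, `E(ℚ) = ⟨P⟩ ⊕ (odd): `m_E ≡ 2 (mod 4)` iff the reduction map `E(ℚ) → Ẽ(𝔽₂) ⊗ ℤ/2 ≅ ℤ/2` is onto, and `8 ∣ m_E` otherwise**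
(409 / 409: 270 + 139).  NEGATIVE (ENGINE 37k2): the 2-adic DEPTH of `P` in `E(ℚ₂)/torsion ≅ ℤ₂` is NOT the invariant — `k₂(P) = 0` with `8 ∣ m_E` on 28 curves and
`k₂(P) ≥ 1` with `m_E ≡ 2 (4)` on 55 (class B, `Δ < 0`); the discrepancy is exactly the curves with a `ℚ₂`-rational 4- or 8-torsion point (`E(ℚ₂)[2^∞] ≅ ℤ/2^a`,
`a = 1 / 2 / 3` on 338 / 234 / 68 class-B prime-level rank-1 curves, e.g. `89a1`: `a = 3`; class C: `a = 1` on 320 / 320).  The congruence module sees the ÉTALE QUOTIENT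
of the local Kummer class (the Greenberg coordinate), not the formal-group depth. -/

/-- `P = (x, y)` REDUCES INTO `2Ẽ(𝔽₂)`: `P ∈ E₁(ℚ₂) + 2E(ℚ₂)`, i.e. for some `Q ∈ E(ℚ₂)` the point `P − 2Q` is `O` or has non-integral abscissa.  On ordinary curves
`⟺ ¬ EtaleKummerOddAtTwo W x` (58 041 / 58 041). -/
def ReducesIntoTwiceAtTwo (W : WeierstrassCurve ℚ) (x y : ℚ) : Prop :=
  ∀ h₂ : (W.baseChange ℚ_[2]).toAffine.Nonsingular ((x : ℚ) : ℚ_[2]) ((y : ℚ) : ℚ_[2]),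
    ∃ Q : (W.baseChange ℚ_[2]).toAffine.Point,
      ∀ (x' y' : ℚ_[2]) (h' : (W.baseChange ℚ_[2]).toAffine.Nonsingular x' y'),
        WeierstrassCurve.Affine.Point.some ((x : ℚ) : ℚ_[2]) ((y : ℚ) : ℚ_[2]) h₂ - 2 • Q = WeierstrassCurve.Affine.Point.some x' y' h' → 1 < ‖x'‖

/-- **ES-37R `PrimeLevelReductionDichotomyAtTwo`** (R ∧ Q3 restated through the reduction map; 409 / 409 = 270 at `v₂(m_E) = 1` + 139 at `8 ∣ m_E`, smallest 53a1 /
797a1): optimal `E`, `N` an odd prime, `E(ℚ)[2] = 0`, ordinary at 2 with `Δ ≡ 3 (mod 4)` and `Δ < 0`, `rank E(ℚ) = 1`, `P ∉ 2E(ℚ)`: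
if `P mod 2 ∉ 2Ẽ(𝔽₂)` then `m_E ≡ 2 (mod 4)`, else `8 ∣ m_E`.  Cheapest falsifier: one such curve with `m_E ≡ 4 (mod 8)`, or with `4 ∣ m_E` and `x(P) ∈ ℤ₂`, `#Ẽ(𝔽₂) = 2`. -/
@[conjecture] def PrimeLevelReductionDichotomyAtTwo : Prop :=
  ∀ (W : WeierstrassCurve ℚ) [W.IsElliptic] [W.IsGloballyMinimal] [NeZero (W.conductorNorm ℤ)]
    (D : ModularParametrizationData W (W.conductorNorm ℤ)),
    (∀ (W'' : WeierstrassCurve ℚ) [W''.IsElliptic] (D'' : ModularParametrizationData W'' (W.conductorNorm ℤ)),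
        D''.f = D.f → D.modularDegree ≤ D''.modularDegree) →
    (W.conductorNorm ℤ).Prime → ¬ 2 ∣ W.conductorNorm ℤ → IsOrdinaryAtTwo W →
    Nat.card (W.toAffine.Point[(2 : ℤ)]) = 1 → W.Δ < 0 → (∃ m : ℤ, W.Δ = 4 * (m : ℚ) + 3) → W.mordellWeilRank = 1 →
    ∀ (x y : ℚ) (h : W.toAffine.Nonsingular x y), WeierstrassCurve.Affine.Point.some x y h ∉ twiceMordellWeil W →
      (¬ ReducesIntoTwiceAtTwo W x y → D.modularDegree % 4 = 2) ∧ (ReducesIntoTwiceAtTwo W x y → 8 ∣ D.modularDegree)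

/-- The dichotomy pins `v₂(m_E) ∈ {1} ∪ [3, ∞)`: `m_E mod 8 ∈ {2, 6, 0}`, never `4`. -/
theorem mod_eight_ne_four_of_dichotomy {m : ℕ} (h : m % 4 = 2 ∨ 8 ∣ m) : m % 8 ≠ 4 := by
  rcases h with h | h <;> omega



/-! ## v4 — THE ν-LAW (CensusES37 §14): at prime level and rank 1 the bit `ν(E) := [m_E ≡ 2 (mod 4)]` is DECIDED by the Mordell–Weil generator

2 × 2 tables (prime `N < 5·10⁵`, optimal, `E(ℚ)[2] = 0`, `Δ ∉ ℚ^{×2}`, rank 1): `Δ < 0` ordinary (classes B ∪ C ∪ D): `ν = 1` ⟺ the generator is GENERIC at 2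
(`P mod 2 ∉ 2Ẽ(𝔽₂)`, and `ℚ₂(½P)/ℚ₂` Gaussian-odd when `Δ ≡ 1 (mod 4)`) — (1,1) 395, (0,0) 414, off-diagonal 0: **809 / 809**, `Ш` playing no role; `Δ > 0` with
`ρ̄_{E,2}` ramified at 2 (A ∪ B): `ν = 1` ⟺ `P ∉ E⁰(ℝ)` (the generator lies ON THE EGG) ∧ `Ш_an = 1` ∧ (ordinary → `P mod 2 ∉ 2Ẽ(𝔽₂)`) — (1,1) 436, (0,0) 274,
off-diagonal 0: **710 / 710**; the ordinary `Δ ≡ 1 (mod 4)`, `Δ > 0` cells are RIGID: `4 ∣ m_E` at every rank (465 / 465, `PrimeLevelGaussianRealDepthAtTwo`); the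
supersingular `Δ < 0` cell is inert (`ν = 1` on 375 / 784, no local predictor).  Forward halves = R / R⁺ above; converse halves = the LAW-M floor at `ω = 1`; typed
here as one `↔` (`Δ < 0`) and one converse (`Δ > 0`, where `Ш` blocks the `↔`).  BRIDGE to the analytic lens (crux idea `modular-degree-mod-four`, AN-35: for
`Δ > 0`, `ν = 1` puts a twisted-real point — hence a 3-cycle Heegner point — on the egg): at prime level `ν = 1` forces THE GENERATOR ITSELF onto the egg
(`PrimeLevelRealNuConverseAtTwo`, 436 / 436), and conversely a generator on the egg with `Ш(E)[2] = 0` (and `φ₂(P) = 1` if ordinary) gives `ν = 1` (R⁺).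
Composite level is different: among `Ш_an`-odd rank-1 curves with `ω(N) ∈ {2, 3}` only 39–55 % sit at the LAW-M floor (old-form congruences add depth). -/

/-- **ES-37ν·N1 `PrimeLevelNuLawAtTwo`** — R as an EQUIVALENCE.  `N` an odd prime, `E` optimal, `E(ℚ)[2] = 0`, ordinary at 2, `Δ < 0`, rank 1, `P ∈ E(ℚ) ∖ 2E(ℚ)`:
`m_E ≡ 2 (mod 4)` **iff** `P` is generic at 2 (`x(P) − e₀ ∉ ℚ₂^{×2}`, and the Gaussian symbol odd when `Δ ≡ 1 (mod 4)`).  CENSUS 809 / 809 (B 270 | 139, C 69 | 141,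
D 56 | 134; smallest non-generic: 797a1 (B, `v₂ = 3`), 331a1 (C, `2`), 4799b1 (D, `3`)).  `→` is LAW M at `ω = 1` (a special generator raises the floor to 2), `←` is R.
Why it might fail: as R (a generic generator with `Ш(E)[2] ≠ 0`), or a special generator on a curve with `m_E ≡ 2 (mod 4)` (kills LAW M itself).
[cite: CalegariEmerton2009, §3.4] [cite: Watkins2002, Conj. 4.1] [cite: BrumerKramer1977, §7] -/
@[conjecture] def PrimeLevelNuLawAtTwo : Prop :=
  ∀ (W : WeierstrassCurve ℚ) [W.IsElliptic] [W.IsGloballyMinimal] [NeZero (W.conductorNorm ℤ)]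
    (D : ModularParametrizationData W (W.conductorNorm ℤ)),
    (∀ (W'' : WeierstrassCurve ℚ) [W''.IsElliptic] (D'' : ModularParametrizationData W'' (W.conductorNorm ℤ)),
        D''.f = D.f → D.modularDegree ≤ D''.modularDegree) →
    (W.conductorNorm ℤ).Prime → ¬ 2 ∣ W.conductorNorm ℤ → IsOrdinaryAtTwo W →
    Nat.card (W.toAffine.Point[(2 : ℤ)]) = 1 → W.Δ < 0 → W.mordellWeilRank = 1 →
    ∀ (x y : ℚ) (h : W.toAffine.Nonsingular x y), WeierstrassCurve.Affine.Point.some x y h ∉ twiceMordellWeil W →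
      (D.modularDegree % 4 = 2 ↔ (EtaleKummerOddAtTwo W x ∧ (GaussianSignAtTwo W → GaussianOddAtTwo W x)))

/-- N1 contains R. -/
theorem kummerReciprocity_of_nuLaw (h : PrimeLevelNuLawAtTwo) : PrimeLevelKummerReciprocityAtTwo := by
  intro W _ _ _ D hopt hN h2 hord ht hΔ hr x y hns hP hEt hG
  exact (h W D hopt hN h2 hord ht hΔ hr x y hns hP).2 ⟨hEt, hG⟩

/-- **ES-37ν·N2 `PrimeLevelRealNuConverseAtTwo`** — the `Δ > 0` converse (the `↔` needs `Ш`): `N` an odd prime, `E` optimal, `E(ℚ)[2] = 0`, `0 < Δ ∉ ℚ^{×2}`, `ρ̄_{E,2}`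
ramified at 2 (supersingular, or `Δ ≡ 3 (mod 4)`), rank 1, `P ∈ E(ℚ) ∖ 2E(ℚ)`: `m_E ≡ 2 (mod 4)` ⟹ `P ∉ E⁰(ℝ)` (the generator is ON THE EGG: the halving quartic has no
real root) and, if ordinary, `P mod 2 ∉ 2Ẽ(𝔽₂)`.  CENSUS 710 / 710 (436 curves with `m_E ≡ 2 (mod 4)`: A 330, B 106, all generic; 274 with `4 ∣ m_E`: generator on `E⁰(ℝ)`
A 144 / B 69 — smallest 997a1, 359a1 —, on the egg but special at 2: B 50 — 3391a1 —, generic with `Ш_an = 4`: 11).  The class `{ν = 1}` of AN-35 is, at prime level, the class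
«generator on the egg, `Ш[2] = 0` (, `φ₂ = 1`)».  Why it might fail: a prime-conductor rank-1 curve with `m_E ≡ 2 (mod 4)` and generator on the identity real component (kills
LAW H at `ω = 1`).
[cite: CalegariEmerton2009, Thm. 1, Lemma 9] [cite: Watkins2002, Conj. 4.1] [cite: GrossZagier1986, V.2] -/
@[conjecture] def PrimeLevelRealNuConverseAtTwo : Prop :=
  ∀ (W : WeierstrassCurve ℚ) [W.IsElliptic] [W.IsGloballyMinimal] [NeZero (W.conductorNorm ℤ)]
    (D : ModularParametrizationData W (W.conductorNorm ℤ)),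
    (∀ (W'' : WeierstrassCurve ℚ) [W''.IsElliptic] (D'' : ModularParametrizationData W'' (W.conductorNorm ℤ)),
        D''.f = D.f → D.modularDegree ≤ D''.modularDegree) →
    (W.conductorNorm ℤ).Prime → ¬ 2 ∣ W.conductorNorm ℤ →
    Nat.card (W.toAffine.Point[(2 : ℤ)]) = 1 → 0 < W.Δ → ¬ IsSquare W.Δ → ¬ (IsOrdinaryAtTwo W ∧ GaussianSignAtTwo W) → W.mordellWeilRank = 1 →
    ∀ (x y : ℚ) (h : W.toAffine.Nonsingular x y), WeierstrassCurve.Affine.Point.some x y h ∉ twiceMordellWeil W →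
      D.modularDegree % 4 = 2 → (¬ HalvingQuarticSolvable W ℝ x ∧ (IsOrdinaryAtTwo W → EtaleKummerOddAtTwo W x))

/-- **ES-37ν·Q4 `PrimeLevelGaussianRealDepthAtTwo`** (Mordell–Weil-free, every rank).  `N` an odd prime, `E` optimal, `E(ℚ)[2] = 0`, ordinary at 2 with `Δ ≡ 1 (mod 4)`
(`ρ̄_{E,2}` unramified at 2) and `0 < Δ ∉ ℚ^{×2}` ⟹ `4 ∣ m_E`: two weight-one places (`∞` and the Gaussian place 2) of which one generator absorbs at most one.
CENSUS 465 / 465 (`Δ ≡ 5 (8)`: 236 = rank 0: 68 `{2: 39, 3: 11, ≥4: 18}`, rank 1: 110, rank 2: 49, rank 3: 9; `Δ ≡ 1 (8)`: 229 = 70 + 104 + 47 + 8; smallest 229a1 (`v₂ = 3`),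
733a1 (`4`), 2089a1/c1 (`2`)); rank 2 reaches `v₂ = 2` (14389a1, 4481c1), so the law is `4 ∣ m_E`, not `2^{r+1} ∣ m_E`.  Calegari–Emerton give `2 ∣ m_E`; Watkins' `2^r ∣ m_E`
gives nothing at rank ≤ 1.  Why it might fail: one optimal prime-conductor curve in the cell with `m_E ≡ 2 (mod 4)`.
[cite: CalegariEmerton2009, Thm. 1] [cite: Watkins2002, Conj. 4.1] [cite: KedlayaMedvedovsky2019, Conj. 13] -/
@[conjecture] def PrimeLevelGaussianRealDepthAtTwo : Prop :=
  ∀ (W : WeierstrassCurve ℚ) [W.IsElliptic] [W.IsGloballyMinimal] [NeZero (W.conductorNorm ℤ)]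
    (D : ModularParametrizationData W (W.conductorNorm ℤ)),
    (∀ (W'' : WeierstrassCurve ℚ) [W''.IsElliptic] (D'' : ModularParametrizationData W'' (W.conductorNorm ℤ)),
        D''.f = D.f → D.modularDegree ≤ D''.modularDegree) →
    (W.conductorNorm ℤ).Prime → ¬ 2 ∣ W.conductorNorm ℤ → IsOrdinaryAtTwo W → GaussianSignAtTwo W →
    Nat.card (W.toAffine.Point[(2 : ℤ)]) = 1 → 0 < W.Δ → ¬ IsSquare W.Δ → 4 ∣ D.modularDegree

/-- **ES-37ν `PrimeLevelNuPacketAtTwo`** = N1 ∧ N2 ∧ Q4 (809 + 710 + 465 = 1 984 prime-level instances, 0 exceptions). -/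
@[conjecture] def PrimeLevelNuPacketAtTwo : Prop :=
  PrimeLevelNuLawAtTwo ∧ PrimeLevelRealNuConverseAtTwo ∧ PrimeLevelGaussianRealDepthAtTwo

theorem nuLaw_of_nuPacket (h : PrimeLevelNuPacketAtTwo) : PrimeLevelNuLawAtTwo := h.1
theorem realNuConverse_of_nuPacket (h : PrimeLevelNuPacketAtTwo) : PrimeLevelRealNuConverseAtTwo := h.2.1
theorem gaussianRealDepth_of_nuPacket (h : PrimeLevelNuPacketAtTwo) : PrimeLevelGaussianRealDepthAtTwo := h.2.2
theorem kummerReciprocity_of_nuPacket (h : PrimeLevelNuPacketAtTwo) : PrimeLevelKummerReciprocityAtTwo := kummerReciprocity_of_nuLaw h.1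

end Summit.BirchSwinnertonDyer.BirchSwinnertonDyer.Theorems.RankOneAtTwoGaussianNorm

end
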